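import Mathlib
import HarnessLib
import Summits.NavierStokesRegularity.NavierStokesRegularity.Theorems.PoloidalWindowDoorLrcModEntireSheetFlattenTools

/-!
# Route `PoloidalWindowDoor`, item `LrcModEntire` (stmt-NavierStokesRegularity-20428), cell (Q4-sonic, straight, μ < 0) `stub_Q4sonicLineNeg`, case II —
# BRICK B-TWPc, PART T4: THE SHEET IS NON-VERTICAL AT SMALL TIMES (`d₁′ ≠ 0` on a height window) — refuter1 DUTY-C13 (D2)(iv), second point

Cell ns-regularity-ideate, stub-worker seat ns-poloidal-K2-p2 g18 under the LEAD of item 20428 (ns-poloidal-K2-p3 g17/g18);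
`--supports stmt-NavierStokesRegularity-20428 --as helper`.  Memo `Cruxes/LrcModEntire/TOWER-CLOSES-port2g9.md` §D2 («`d_{τ₁}′(0)² → −μ₀ > 0` as `τ₁ → 0`, so
the sheet is non-vertical near `z = 0`»), LEAD 2026-08-29T23:13:57Z.  Class-free, in the currency of the curved END
`…CaseIIEntranceSharp.caseII_false_of_curvedEnd'` (δ′-box package `hpack`: `κt > 0` and the line-frame HUYGENS identity
`κt·(∂_z n₀)² = (R_zz − μκt)(1 + (∂_s n₀)²)`; webs parallel at `τ = 0`; the LINE lever «non-sonic ⇒ un-pinned»; `C¹` web function) — NO `τ = 0` normalisation and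
NO sonic literal is assumed: the transversality at `τ = 0` is DERIVED (if `∂_z n₀(0,0,0) = 0` then Huygens gives `R_zz(0,0) = μ(−1,0)κt(0,0) < 0`, so `R(0,·)` is not
affine, so the base web at `τ = 0` is un-pinned by the lever — contradicting the parallel webs at `τ = 0`).

* ★ `transversal_factor_pos_near_zero` — `∃ τ* > 0, ∀ |τ| < τ*: 0 < R_zz(τ,0) − μ(−1+τ,0)·κt(τ,0)` (the Huygens factor at the base height; by the identity it is
  `κt·(∂_z n₀)²/(1 + (∂_s n₀)²)`, positive at `τ = 0` by the argument above and nearby by continuity of `∂n₀`);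
* ★ `fermi_offset_transversal` — for the local Fermi-frame time-web function `G₁` of T3b (`C^∞` on the box, pin `G₁(τ₁,σ,0) = 0`, Fermi Huygens family) and a
  base time with positive Huygens factor at the base height: `∂_zG₁(τ₁,σ₀,z) ≠ 0` for `|z| < ε₂` — the parallel offset `d₁ = G₁(τ₁,σ₀,·)` has `d₁′ ≠ 0` on a height window (at the pin
  `J = 1`, `∂_σG₁ = 0`, so `κt·(∂_zG₁)² = R_zz − μκt > 0`; then continuity).

WHAT THIS IS NOT: not a claim about Navier–Stokes regularity; closes nothing; items 20428 / 19708 / 27893 OPEN (bears_on LADDER-NS N0).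
-/

noncomputable section

set_option linter.dupNamespace false
set_option linter.style.longLine false

namespace Summit.NavierStokesRegularity.NavierStokesRegularity.Theorems.PoloidalWindowDoorLrcModEntireFermiTimeWebNonVertical

open Set Function Filter Topology Metric
open scoped RealInnerProductSpace InnerProductSpace ContDiff
open Summit.NavierStokesRegularity.NavierStokesRegularity.Theorems.PoloidalWindowDoorLrcModEntireSheetFlattenTools

/-- An affine function on `|z| < δ` has vanishing second derivative at `0`. -/
theorem deriv_deriv_eq_zero_of_affine {f : ℝ → ℝ} {δ a b : ℝ} (hδ : 0 < δ) (haff : ∀ z : ℝ, |z| < δ → f z = a + b * z) :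
    deriv (deriv f) 0 = 0 := by
  have hopen : IsOpen {z : ℝ | |z| < δ} := isOpen_lt continuous_abs continuous_const
  have hev : ∀ z : ℝ, |z| < δ → deriv f z = b := by
    intro z hz
    have h : f =ᶠ[𝓝 z] fun w => a + b * w := Filter.eventuallyEq_of_mem (hopen.mem_nhds hz) fun w hw => haff w hw
    rw [h.deriv_eq]
    have hd : HasDerivAt (fun w : ℝ => a + b * w) b z := by
      simpa using ((hasDerivAt_id z).const_mul b).const_add a
    exact hd.deriv
  have h2 : deriv f =ᶠ[𝓝 (0 : ℝ)] fun _ => b :=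
    Filter.eventuallyEq_of_mem (hopen.mem_nhds (by simpa using hδ)) fun w hw => hev w hw
  rw [h2.deriv_eq, deriv_const]

/-- ★ **THE HUYGENS FACTOR AT THE BASE HEIGHT IS POSITIVE FOR ALL SMALL TIMES.**  Currency of the curved END: the `δ′`-box package (here only: `κt > 0`, the
line-frame Huygens identity, `C¹` regularity of `n₀`), webs parallel at `τ = 0`, `μ(−1,0) < 0`, and the LINE lever (non-sonic ⇒ un-pinned) on the `δ′`-window. -/
theorem transversal_factor_pos_near_zero {n₀ : ℝ × ℝ × ℝ → ℝ} {R μ κt : ℝ → ℝ → ℝ} {δ δ' : ℝ} (hδ : 0 < δ) (hδ' : 0 < δ')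
    (hC1 : ∀ q : ℝ × ℝ × ℝ, |q.1| < δ' → |q.2.2| < δ' → ContDiffAt ℝ 1 n₀ q)
    (hκ : ∀ q : ℝ × ℝ × ℝ, |q.1| < δ' → |q.2.2| < δ' → 0 < κt q.1 q.2.2)
    (hHuy : ∀ q : ℝ × ℝ × ℝ, |q.1| < δ' → |q.2.2| < δ' →
      κt q.1 q.2.2 * (fderiv ℝ n₀ q ((0 : ℝ), (0 : ℝ), (1 : ℝ))) ^ 2 =
        (deriv (deriv (R q.1)) q.2.2 - μ (-1 + q.1) q.2.2 * κt q.1 q.2.2) * (1 + (fderiv ℝ n₀ q ((0 : ℝ), (1 : ℝ), (0 : ℝ))) ^ 2))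
    (hpar0 : ∀ s z : ℝ, |z| < δ' → n₀ ((0 : ℝ), s, z) = n₀ ((0 : ℝ), (0 : ℝ), z))
    (hμ0 : μ (-1) 0 < 0)
    (hunpin : ∀ τ : ℝ, |τ| < δ' → ¬ (∃ a b : ℝ, ∀ z : ℝ, |z| < δ → R τ z = a + b * z) →
      ∃ s : ℝ, n₀ (τ, s, (0 : ℝ)) ≠ n₀ (τ, (0 : ℝ), (0 : ℝ))) :
    ∃ τs : ℝ, 0 < τs ∧ τs ≤ δ' ∧ ∀ τ : ℝ, |τ| < τs → 0 < deriv (deriv (R τ)) 0 - μ (-1 + τ) 0 * κt τ 0 := by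
  have h0δ' : |(0 : ℝ)| < δ' := by simpa using hδ'
  -- the Huygens factor equals `κt·(∂_z n₀)²/(1 + (∂_s n₀)²)` at the base height
  have hfac : ∀ τ : ℝ, |τ| < δ' → deriv (deriv (R τ)) 0 - μ (-1 + τ) 0 * κt τ 0 =
      κt τ 0 * (fderiv ℝ n₀ (τ, 0, 0) ((0 : ℝ), (0 : ℝ), (1 : ℝ))) ^ 2 / (1 + (fderiv ℝ n₀ (τ, 0, 0) ((0 : ℝ), (1 : ℝ), (0 : ℝ))) ^ 2) := by
    intro τ hτ
    have h := hHuy (τ, 0, 0) hτ h0δ'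
    have hpos : (0 : ℝ) < 1 + (fderiv ℝ n₀ (τ, 0, 0) ((0 : ℝ), (1 : ℝ), (0 : ℝ))) ^ 2 := by positivity
    rw [eq_div_iff hpos.ne']
    simpa using h.symm
  -- at `τ = 0` the vertical derivative of the web function does not vanish
  have hz0 : fderiv ℝ n₀ (0, 0, 0) ((0 : ℝ), (0 : ℝ), (1 : ℝ)) ≠ 0 := by
    intro hzero
    have h := hHuy (0, 0, 0) h0δ' h0δ'
    rw [hzero] at h
    have hpos : (0 : ℝ) < 1 + (fderiv ℝ n₀ (0, 0, 0) ((0 : ℝ), (1 : ℝ), (0 : ℝ))) ^ 2 := by positivity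
    have hR : deriv (deriv (R 0)) 0 = μ (-1 + 0) 0 * κt 0 0 := by
      have : (deriv (deriv (R 0)) 0 - μ (-1 + 0) 0 * κt 0 0) * (1 + (fderiv ℝ n₀ (0, 0, 0) ((0 : ℝ), (1 : ℝ), (0 : ℝ))) ^ 2) = 0 := by
        simpa using h.symm
      have h2 := (mul_eq_zero.1 this).resolve_right hpos.ne'
      linarith
    have hneg : deriv (deriv (R 0)) 0 < 0 := by
      rw [hR, add_zero]
      exact mul_neg_of_neg_of_pos hμ0 (by simpa using hκ (0, 0, 0) h0δ' h0δ')
    -- so `R(0,·)` is not affine, and the lever un-pins the base web at `τ = 0` — contradicting the parallel webs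
    have hns : ¬ (∃ a b : ℝ, ∀ z : ℝ, |z| < δ → R 0 z = a + b * z) := by
      rintro ⟨a, b, haff⟩
      have := deriv_deriv_eq_zero_of_affine hδ haff
      linarith
    obtain ⟨s, hs⟩ := hunpin 0 h0δ' hns
    exact hs (hpar0 s 0 h0δ')
  -- continuity of `τ ↦ ∂n₀(τ,0,0)` at `τ = 0`
  have hline : Continuous (fun τ : ℝ => ((τ, (0 : ℝ), (0 : ℝ)) : ℝ × ℝ × ℝ)) := continuous_id.prodMk continuous_const
  have hDc : ContinuousAt (fderiv ℝ n₀) ((0 : ℝ), (0 : ℝ), (0 : ℝ)) :=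
    ((hC1 (0, 0, 0) h0δ' h0δ').fderiv_right (m := 0) (by norm_num)).continuousAt
  have hcomp : ContinuousAt (fun τ : ℝ => fderiv ℝ n₀ (τ, 0, 0)) 0 :=
    ContinuousAt.comp (g := fderiv ℝ n₀) (f := fun τ : ℝ => ((τ, (0 : ℝ), (0 : ℝ)) : ℝ × ℝ × ℝ)) (x := (0 : ℝ)) hDc hline.continuousAt
  have hcz : ContinuousAt (fun τ : ℝ => fderiv ℝ n₀ (τ, 0, 0) ((0 : ℝ), (0 : ℝ), (1 : ℝ))) 0 :=
    hcomp.clm_apply continuousAt_const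
  -- `∂_z n₀(τ,0,0) ≠ 0` for small `τ`
  have hev : ∀ᶠ τ in 𝓝 (0 : ℝ), fderiv ℝ n₀ (τ, 0, 0) ((0 : ℝ), (0 : ℝ), (1 : ℝ)) ≠ 0 :=
    hcz.eventually_ne hz0
  obtain ⟨τ₀, hτ₀, hτ₀ev⟩ := Metric.eventually_nhds_iff.1 hev
  refine ⟨min τ₀ δ', lt_min hτ₀ hδ', min_le_right _ _, fun τ hτ => ?_⟩
  have hτδ' : |τ| < δ' := lt_of_lt_of_le hτ (min_le_right _ _)
  have hτ0 : dist τ 0 < τ₀ := by rw [Real.dist_eq, sub_zero]; exact lt_of_lt_of_le hτ (min_le_left _ _)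
  have hne := hτ₀ev hτ0
  rw [hfac τ hτδ']
  have hκp := hκ (τ, 0, 0) hτδ' h0δ'
  have hsq : 0 < (fderiv ℝ n₀ (τ, 0, 0) ((0 : ℝ), (0 : ℝ), (1 : ℝ))) ^ 2 := by positivity
  positivity

/-- ★ **THE PARALLEL OFFSET IS TRANSVERSAL: `∂_zG₁(τ₁,σ₀,z) ≠ 0` on a height window.**  Class-free, in the currency of T3b-2 `…FermiTimeWebPackage.fermi_timeWeb_package`:
`G₁` `C^∞` on the box, the pin `G₁(τ₁,σ,0) = 0`, the Fermi Huygens family at the base points `(τ₁,σ₀,z)`, and a positive Huygens factor at the base height. -/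
theorem fermi_offset_transversal {G₁ : ℝ × ℝ × ℝ → ℝ} {R μ κt : ℝ → ℝ → ℝ} {k₁ : ℝ → ℝ} {τ₁ σ₀ ε₁ : ℝ} (hε₁ : 0 < ε₁)
    (hG₁ : ContDiffOn ℝ ∞ G₁ {q : ℝ × ℝ × ℝ | |q.1 - τ₁| < ε₁ ∧ |q.2.1 - σ₀| < ε₁ ∧ |q.2.2| < ε₁})
    (hpin : ∀ s : ℝ, |s - σ₀| < ε₁ → G₁ (τ₁, s, 0) = 0)
    (hHuy : ∀ z : ℝ, |z| < ε₁ →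
      κt τ₁ z * (1 - k₁ σ₀ * G₁ (τ₁, σ₀, z)) ^ 2 * (fderiv ℝ G₁ (τ₁, σ₀, z) ((0 : ℝ), (0 : ℝ), (1 : ℝ))) ^ 2 =
        (deriv (deriv (R τ₁)) z - μ (-1 + τ₁) z * κt τ₁ z) *
          ((1 - k₁ σ₀ * G₁ (τ₁, σ₀, z)) ^ 2 + (fderiv ℝ G₁ (τ₁, σ₀, z) ((0 : ℝ), (1 : ℝ), (0 : ℝ))) ^ 2))
    (hpos : 0 < deriv (deriv (R τ₁)) 0 - μ (-1 + τ₁) 0 * κt τ₁ 0) :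
    ∃ ε₂ : ℝ, 0 < ε₂ ∧ ε₂ ≤ ε₁ ∧ ∀ z : ℝ, |z| < ε₂ → fderiv ℝ G₁ (τ₁, σ₀, z) ((0 : ℝ), (0 : ℝ), (1 : ℝ)) ≠ 0 := by
  set B : Set (ℝ × ℝ × ℝ) := {q : ℝ × ℝ × ℝ | |q.1 - τ₁| < ε₁ ∧ |q.2.1 - σ₀| < ε₁ ∧ |q.2.2| < ε₁} with hB
  have hBo : IsOpen B :=
    (isOpen_lt (continuous_fst.sub continuous_const).abs continuous_const).inter
      ((isOpen_lt ((continuous_fst.comp continuous_snd).sub continuous_const).abs continuous_const).inter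
        (isOpen_lt (continuous_snd.comp continuous_snd).abs continuous_const))
  have hq₀ : ((τ₁, σ₀, (0 : ℝ)) : ℝ × ℝ × ℝ) ∈ B := ⟨by simpa using hε₁, by simpa using hε₁, by simpa using hε₁⟩
  -- at the pin: `G₁ = 0`, `∂_σG₁ = 0`
  have hG0 : G₁ (τ₁, σ₀, 0) = 0 := hpin σ₀ (by simpa using hε₁)
  have hGd : DifferentiableAt ℝ G₁ (τ₁, σ₀, 0) := (hG₁.contDiffAt (hBo.mem_nhds hq₀)).differentiableAt (by simp)
  have hGσ : fderiv ℝ G₁ (τ₁, σ₀, 0) ((0 : ℝ), (1 : ℝ), (0 : ℝ)) = 0 := by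
    have hl : HasDerivAt (fun s : ℝ => ((τ₁, s, (0 : ℝ)) : ℝ × ℝ × ℝ)) ((0 : ℝ), (1 : ℝ), (0 : ℝ)) σ₀ := by
      have h1 := ((hasDerivAt_id σ₀).prodMk (hasDerivAt_const σ₀ (0 : ℝ)))
      simpa using (hasDerivAt_const σ₀ τ₁).prodMk h1
    have hc := hGd.hasFDerivAt.comp_hasDerivAt σ₀ hl
    have hev : (fun s : ℝ => G₁ (τ₁, s, 0)) =ᶠ[𝓝 σ₀] fun _ => 0 :=
      Filter.eventuallyEq_of_mem ((isOpen_lt (continuous_id.sub continuous_const).abs continuous_const).mem_nhds (by simpa using hε₁))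
        fun s hs => hpin s hs
    have h0 : deriv (fun s : ℝ => G₁ (τ₁, s, 0)) σ₀ = 0 := by rw [hev.deriv_eq, deriv_const]
    have h1 : deriv (fun s : ℝ => G₁ (τ₁, s, 0)) σ₀ = fderiv ℝ G₁ (τ₁, σ₀, 0) ((0 : ℝ), (1 : ℝ), (0 : ℝ)) := hc.deriv
    rw [h0] at h1
    exact h1.symm
  -- Huygens at the pin: `κt·(∂_zG₁)² = factor > 0`
  have hGz0 : fderiv ℝ G₁ (τ₁, σ₀, 0) ((0 : ℝ), (0 : ℝ), (1 : ℝ)) ≠ 0 := by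
    intro hzero
    have h := hHuy 0 (by simpa using hε₁)
    rw [hzero, hG0, hGσ] at h
    simp only [mul_zero, sub_zero, ne_eq, OfNat.ofNat_ne_zero, not_false_eq_true, zero_pow, one_pow, add_zero, mul_one] at h
    linarith
  -- continuity of `z ↦ ∂_zG₁(τ₁,σ₀,z)` at `0`
  have hD : ContinuousOn (fderiv ℝ G₁) B := (hG₁.fderiv_of_isOpen hBo (m := 0) (by simp)).continuousOn
  have hline : Continuous (fun z : ℝ => ((τ₁, σ₀, z) : ℝ × ℝ × ℝ)) := continuous_const.prodMk (continuous_const.prodMk continuous_id)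
  have hcomp : ContinuousAt (fun z : ℝ => fderiv ℝ G₁ (τ₁, σ₀, z)) 0 :=
    ContinuousAt.comp (g := fderiv ℝ G₁) (f := fun z : ℝ => ((τ₁, σ₀, z) : ℝ × ℝ × ℝ)) (x := (0 : ℝ))
      (hD.continuousAt (hBo.mem_nhds hq₀)) hline.continuousAt
  have hcz : ContinuousAt (fun z : ℝ => fderiv ℝ G₁ (τ₁, σ₀, z) ((0 : ℝ), (0 : ℝ), (1 : ℝ))) 0 :=
    hcomp.clm_apply continuousAt_const
  have hev := hcz.eventually_ne hGz0
  obtain ⟨ε₀, hε₀, hε₀ev⟩ := Metric.eventually_nhds_iff.1 hev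
  refine ⟨min ε₀ ε₁, lt_min hε₀ hε₁, min_le_right _ _, fun z hz => ?_⟩
  exact hε₀ev (by rw [Real.dist_eq, sub_zero]; exact lt_of_lt_of_le hz (min_le_left _ _))

end Summit.NavierStokesRegularity.NavierStokesRegularity.Theorems.PoloidalWindowDoorLrcModEntireFermiTimeWebNonVertical

end
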